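import Summits.PneNP.PneNP.Theorems.ClusUniversalCertificateLayerDefs
import Mathlib
import HarnessLib

/-!
# Route ClusUniversalCertificate — line `layer` on the crux `UniversalCertAll` (stmt-PneNP-19683): the two-block base
(rung F-N1, cell pnp-ideate, planner p1 g6; registered skeleton HOME/pnp-ideate-p1/lines/layer.lean v2 sha16 cfd997240e04, card
lines/layer.md §UC2; stub 3 `stub_ucLeTwo : UCLeTwo`, M–L, WANTED for an idle prover on STATUS 07:19Z; referee g32 verified the paper
proof of §UC2 step by step, SCORE-p1-R6.md)

The registered stub `stub_ucLeTwo : UCLeTwo` of p1's line `layer`, BY NAME, against the objects of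
`ClusUniversalCertificateLayerDefs.lean` (p511857): the universal block certificate
`Σ_{y∈Y} (n − codim_Y(y)) ≤ Σ_{k<n} 2^m · #{y ∈ Y : y_k = 0}` for at most two blocks (`n ≤ 2`) and every `m`.

PROOF (line card §UC2, column domination).
* `codim_Y(y) = 0` for some `y ∈ Y` forces `Y = univ` (a flat inside `Y` of full dimension is everything), and for `Y = univ` the
  certificate is an EQUALITY for every `n` (`ucIneq_univ`: `2^m · #{y : y_k = 0} = #univ` by translating the fibres of `y ↦ y_k`).
  This settles `n ≤ 1` (all terms `≤ 0` otherwise) and leaves `n = 2`, `Y ≠ univ`, where every point has `codim ≥ 1`, so the left side is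
  at most the number of points of `codim` exactly `1`; such a point lies on an affine hyperplane `{f = f(y)} ⊆ Y`
  (`exists_functional_of_codimY_eq_one`: a direction of dimension `2m − 1` is the kernel of a nonzero functional).
* COLUMNS (`card_codimOne_le`): split these points `U` by their first block `a = y_0`.  Columns with `(a, 0) ∈ Y` number `Z_1(Y)` and hold
  `≤ 2^m` points each.  A column with `(a, 0) ∉ Y` is DOMINATED by the column of `Y` over `a = 0`: for `(a, b) ∈ U` on `{f = c} ⊆ Y` write
  `f(a', b') = ψ(a') + φ(b')`; the column of the hyperplane at `a` misses `b' = 0`, so `φ(b) = 1`, while its column at `a' = 0`,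
  `{φ = c}`, lies in `Y_0`.  The COSET LEMMA (`card_le_of_cosets`): for functionals `φ_i` and constants `c_i` on `V = 𝔽₂^m`,
  `|⋃_i {φ_i = 1}| ≤ |⋃_i {φ_i = c_i}|` — the complement of the right side translates injectively into the complement of the left side.
  Hence such a column holds `≤ Z_0(Y)` points, there are `≤ 2^m` of them, and `|U| ≤ 2^m (Z_0 + Z_1)`.

HONEST FRAMING: ONE registered stub (a two-block counting theorem about affine flats in `(𝔽₂^m)^2`) of an OPEN crux of route
ClusUniversalCertificate; the load-bearing stub `stub_layerLemma3 : LayerLemmaFrom3` is OPEN and XL; FRONTIER rung F-N1 — nothing here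
bears on P vs NP.
-/

set_option linter.dupNamespace false -- `Summit.PneNP.PneNP.…`: summit = sub-problem name (D-0017 single-conjunct layout)

-- BEGIN BODY
namespace Summit.PneNP.PneNP.Theorems.ClusLayer

open Finset
open Summit.PneNP.PneNP.Theorems.ClusSkew (codimY)

/-! ## Arithmetic in `𝔽₂` -/

/-- In `𝔽₂`, two elements avoiding the same value are equal, so their difference is not `1`. -/
theorem zmod2_sub_ne_one {x y c : ZMod 2} (hx : x ≠ c) (hy : y ≠ c) : x - y ≠ 1 := by
  revert x y c; decide

/-! ## The coset lemma -/

/-- **Coset lemma.** For linear functionals `Φ_b` (`b ∈ Ua`) on an `𝔽₂`-space `V` with `Φ_b(b) = 1` and constants `C_b` with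
`{Φ_b = C_b} ⊆ Y0`: `|Ua| ≤ |⋃_b {Φ_b = 1}| ≤ |⋃_b {Φ_b = C_b}| ≤ |Y0|` — the middle step because the complement
`{v : ∀ b, Φ_b v ≠ C_b}` translates (by any of its points) injectively into the complement `{v : ∀ b, Φ_b v ≠ 1}`. -/
theorem card_le_of_cosets {V : Type*} [AddCommGroup V] [Module (ZMod 2) V] [Fintype V] [DecidableEq V]
    (Ua Y0 : Finset V) (Φ : V → V →ₗ[ZMod 2] ZMod 2) (C : V → ZMod 2)
    (h : ∀ b ∈ Ua, Φ b b = 1 ∧ ∀ v, Φ b v = C b → v ∈ Y0) : Ua.card ≤ Y0.card := by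
  classical
  have hUA : Ua ⊆ Finset.univ.filter fun v => ∃ b ∈ Ua, Φ b v = 1 :=
    fun b hb => Finset.mem_filter.mpr ⟨Finset.mem_univ _, b, hb, (h b hb).1⟩
  have hAY : (Finset.univ.filter fun v => ∃ b ∈ Ua, Φ b v = C b) ⊆ Y0 := fun v hv => by
    obtain ⟨b, hb, hv⟩ := (Finset.mem_filter.mp hv).2
    exact (h b hb).2 v hv
  have hc1 := Finset.card_filter_add_card_filter_not (s := (Finset.univ : Finset V))
    (fun v => ∃ b ∈ Ua, Φ b v = 1)
  have hcC := Finset.card_filter_add_card_filter_not (s := (Finset.univ : Finset V))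
    (fun v => ∃ b ∈ Ua, Φ b v = C b)
  -- the complement of `⋃ {Φ_b = C_b}` injects into the complement of `⋃ {Φ_b = 1}`
  have hcomp : (Finset.univ.filter fun v => ¬ ∃ b ∈ Ua, Φ b v = C b).card ≤
      (Finset.univ.filter fun v => ¬ ∃ b ∈ Ua, Φ b v = 1).card := by
    by_cases hne : (Finset.univ.filter fun v => ¬ ∃ b ∈ Ua, Φ b v = C b).Nonempty
    · obtain ⟨v₀, hv₀⟩ := hne
      have hv₀' := (Finset.mem_filter.mp hv₀).2
      apply Finset.card_le_card_of_injOn (fun v => v - v₀)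
      · intro v hv
        have hv' := (Finset.mem_filter.mp hv).2
        refine Finset.mem_coe.mpr (Finset.mem_filter.mpr ⟨Finset.mem_univ _, ?_⟩)
        rintro ⟨b, hb, h1⟩
        rw [map_sub] at h1
        exact zmod2_sub_ne_one (fun e => hv' ⟨b, hb, e⟩) (fun e => hv₀' ⟨b, hb, e⟩) h1
      · intro v _ v' _ hvv'
        exact sub_left_injective hvv'
    · rw [Finset.not_nonempty_iff_eq_empty.mp hne, Finset.card_empty]
      exact Nat.zero_le _
  calc Ua.card ≤ (Finset.univ.filter fun v => ∃ b ∈ Ua, Φ b v = 1).card := Finset.card_le_card hUA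
    _ ≤ (Finset.univ.filter fun v => ∃ b ∈ Ua, Φ b v = C b).card := by omega
    _ ≤ Y0.card := Finset.card_le_card hAY

/-! ## Flats inside `Y`: codimension `0` and `1` -/

section Flats

variable {n m : ℕ}

/-- The ambient space `(𝔽₂^m)^n` has dimension `n·m`. -/
theorem finrank_blocks (n m : ℕ) : Module.finrank (ZMod 2) (Fin n → Fin m → ZMod 2) = n * m := by
  rw [Module.finrank_pi_fintype]
  simp [Module.finrank_fintype_fun_eq_card]

/-- The set in the definition of `codim_Y(y)` is nonempty for `y ∈ Y` (the singleton flat `{y}`). -/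
theorem codimY_set_nonempty (Y : Finset (Fin n → Fin m → ZMod 2)) {y : Fin n → Fin m → ZMod 2} (hy : y ∈ Y) :
    {c : ℕ | ∃ A : AffineSubspace (ZMod 2) (Fin n → Fin m → ZMod 2), y ∈ A ∧ (∀ z ∈ A, z ∈ Y) ∧
      n * m ≤ Module.finrank (ZMod 2) A.direction + c}.Nonempty := by
  refine ⟨n * m, affineSpan (ZMod 2) {y}, mem_affineSpan (ZMod 2) (Set.mem_singleton y), ?_, Nat.le_add_left _ _⟩
  intro z hz
  rw [AffineSubspace.mem_affineSpan_singleton] at hz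
  rw [hz]; exact hy

/-- A flat inside `Y` with direction `⊤` forces `Y = univ`. -/
theorem eq_univ_of_direction_eq_top {Y : Finset (Fin n → Fin m → ZMod 2)}
    {A : AffineSubspace (ZMod 2) (Fin n → Fin m → ZMod 2)} {y : Fin n → Fin m → ZMod 2} (hyA : y ∈ A)
    (hAY : ∀ z ∈ A, z ∈ Y) (hD : A.direction = ⊤) : Y = Finset.univ := by
  have hA : A = ⊤ := (AffineSubspace.direction_eq_top_iff_of_nonempty ⟨y, hyA⟩).mp hD
  exact Finset.eq_univ_iff_forall.mpr fun z => hAY z (hA ▸ AffineSubspace.mem_top (ZMod 2) _ z)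

/-- If `Y ≠ univ`, every point of `Y` has certificate codimension at least `1`. -/
theorem one_le_codimY {Y : Finset (Fin n → Fin m → ZMod 2)} (hY : Y ≠ Finset.univ)
    {y : Fin n → Fin m → ZMod 2} (hy : y ∈ Y) : 1 ≤ codimY m Y y := by
  rw [Nat.one_le_iff_ne_zero]
  intro h0
  obtain ⟨A, hyA, hAY, hc⟩ := Nat.sInf_mem (codimY_set_nonempty Y hy)
  have hc' : n * m ≤ Module.finrank (ZMod 2) A.direction := by
    have : codimY m Y y = 0 := h0
    unfold codimY at this
    rw [this, add_zero] at hc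
    exact hc
  have hD : A.direction = ⊤ :=
    Submodule.eq_top_of_finrank_eq (le_antisymm (Submodule.finrank_le _) (by rw [finrank_blocks]; exact hc'))
  exact hY (eq_univ_of_direction_eq_top hyA hAY hD)

/-- For `Y = univ` every certificate codimension is `0` (the whole space is a flat inside `Y`). -/
theorem codimY_univ (y : Fin n → Fin m → ZMod 2) : codimY m (Finset.univ) y = 0 := by
  apply Nat.eq_zero_of_le_zero
  unfold codimY
  apply Nat.sInf_le
  refine ⟨⊤, AffineSubspace.mem_top (ZMod 2) _ y, fun z _ => Finset.mem_univ z, ?_⟩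
  rw [AffineSubspace.direction_top, finrank_top, finrank_blocks]
  omega

/-- A point of certificate codimension `1` in `Y ≠ univ` lies on an affine hyperplane inside `Y`: there is a linear functional `f`
with `{x : f x = f y} ⊆ Y`. -/
theorem exists_functional_of_codimY_eq_one {Y : Finset (Fin n → Fin m → ZMod 2)} (hY : Y ≠ Finset.univ)
    {y : Fin n → Fin m → ZMod 2} (hy : y ∈ Y) (h1 : codimY m Y y = 1) :
    ∃ f : (Fin n → Fin m → ZMod 2) →ₗ[ZMod 2] ZMod 2, ∀ x, f x = f y → x ∈ Y := by
  obtain ⟨A, hyA, hAY, hc⟩ := Nat.sInf_mem (codimY_set_nonempty Y hy)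
  have hc' : n * m ≤ Module.finrank (ZMod 2) A.direction + 1 := by
    unfold codimY at h1
    rw [h1] at hc
    exact hc
  have hDtop : A.direction ≠ ⊤ := fun hD => hY (eq_univ_of_direction_eq_top hyA hAY hD)
  obtain ⟨f, hf0, hDf⟩ := Submodule.exists_le_ker_of_lt_top _ (lt_top_iff_ne_top.mpr hDtop)
  have hker : LinearMap.ker f ≠ ⊤ := by rwa [Ne, LinearMap.ker_eq_top]
  have hlt := Submodule.finrank_lt hker
  rw [finrank_blocks] at hlt
  have hDeq : A.direction = LinearMap.ker f := Submodule.eq_of_le_of_finrank_le hDf (by omega)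
  refine ⟨f, fun x hx => hAY x ?_⟩
  have hmem : x -ᵥ y ∈ A.direction := by
    rw [hDeq, LinearMap.mem_ker, vsub_eq_sub, map_sub, hx, sub_self]
  exact (AffineSubspace.vsub_right_mem_direction_iff_mem hyA x).mp hmem

/-! ## The certificate for `Y = univ` (equality, every `n`) -/

/-- All fibres of `y ↦ y_k` on `(𝔽₂^m)^n` have the size of the zero fibre (translate by `Pi.single k v`). -/
theorem card_filter_block_eq (k : Fin n) (v : Fin m → ZMod 2) :
    ((Finset.univ : Finset (Fin n → Fin m → ZMod 2)).filter fun y => y k = 0).card =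
      ((Finset.univ : Finset (Fin n → Fin m → ZMod 2)).filter fun y => y k = v).card := by
  apply Finset.card_nbij' (fun y => y + Pi.single k v) (fun y => y - Pi.single k v)
  · intro y hy
    have h := (Finset.mem_filter.mp (Finset.mem_coe.mp hy)).2
    exact Finset.mem_coe.mpr (Finset.mem_filter.mpr ⟨Finset.mem_univ _, by simp [h]⟩)
  · intro y hy
    have h := (Finset.mem_filter.mp (Finset.mem_coe.mp hy)).2
    exact Finset.mem_coe.mpr (Finset.mem_filter.mpr ⟨Finset.mem_univ _, by simp [h]⟩)
  · intro y _; simp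
  · intro y _; simp

/-- `2^m · #{y : y_k = 0} = #(𝔽₂^m)^n`. -/
theorem two_pow_mul_card_filter_block (k : Fin n) :
    2 ^ m * ((Finset.univ : Finset (Fin n → Fin m → ZMod 2)).filter fun y => y k = 0).card =
      Fintype.card (Fin n → Fin m → ZMod 2) := by
  have hfib : (Finset.univ : Finset (Fin n → Fin m → ZMod 2)).card =
      ∑ v : Fin m → ZMod 2, ((Finset.univ : Finset (Fin n → Fin m → ZMod 2)).filter fun y => y k = v).card :=
    Finset.card_eq_sum_card_fiberwise (f := fun y : Fin n → Fin m → ZMod 2 => y k) (s := Finset.univ)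
      (t := Finset.univ) fun _ _ => Finset.mem_coe.mpr (Finset.mem_univ _)
  have hV : Fintype.card (Fin m → ZMod 2) = 2 ^ m := by rw [Fintype.card_fun, ZMod.card, Fintype.card_fin]
  calc 2 ^ m * ((Finset.univ : Finset (Fin n → Fin m → ZMod 2)).filter fun y => y k = 0).card
      = ∑ _v : Fin m → ZMod 2, ((Finset.univ : Finset (Fin n → Fin m → ZMod 2)).filter fun y => y k = 0).card := by
        rw [Finset.sum_const, Finset.card_univ, hV, smul_eq_mul]
    _ = ∑ v : Fin m → ZMod 2, ((Finset.univ : Finset (Fin n → Fin m → ZMod 2)).filter fun y => y k = v).card :=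
        Finset.sum_congr rfl fun v _ => card_filter_block_eq k v
    _ = (Finset.univ : Finset (Fin n → Fin m → ZMod 2)).card := hfib.symm
    _ = Fintype.card (Fin n → Fin m → ZMod 2) := Finset.card_univ

/-- The certificate for `Y = univ` (an equality), every `n` and `m`. -/
theorem ucIneq_univ (n m : ℕ) : UCIneq n m (Finset.univ : Finset (Fin n → Fin m → ZMod 2)) := by
  unfold UCIneq
  have h : ∀ k : Fin n, (2 : ℤ) ^ m *
      ((((Finset.univ : Finset (Fin n → Fin m → ZMod 2)).filter fun y => y k = 0).card : ℕ) : ℤ) =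
        (Fintype.card (Fin n → Fin m → ZMod 2) : ℤ) := by
    intro k; exact_mod_cast two_pow_mul_card_filter_block k
  simp only [codimY_univ, Nat.cast_zero, sub_zero, h, Finset.sum_const, Finset.card_univ, nsmul_eq_mul, Fintype.card_fin]
  rw [mul_comm]

/-! ## Two blocks: column domination -/

/-- `y = (y_0, y_1)` for `y : Fin 2 → V`. -/
theorem vec2_eta (y : Fin 2 → Fin m → ZMod 2) : ![y 0, y 1] = y := by
  funext i; fin_cases i <;> rfl

/-- Points of a set with prescribed first block are determined by their second block. -/
theorem injOn_snd {S : Finset (Fin 2 → Fin m → ZMod 2)} {a : Fin m → ZMod 2} :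
    Set.InjOn (fun y : Fin 2 → Fin m → ZMod 2 => y 1) ↑(S.filter fun y => y 0 = a) := by
  intro y hy y' hy' h
  have e := (Finset.mem_filter.mp (Finset.mem_coe.mp hy)).2
  have e' := (Finset.mem_filter.mp (Finset.mem_coe.mp hy')).2
  have h' : y 1 = y' 1 := h
  rw [← vec2_eta y, ← vec2_eta y', e, e', h']

/-- **Column domination** (line card §UC2): for `Y ⊊ (𝔽₂^m)^2`, the points of certificate codimension `1` number at most
`2^m · (Z_0(Y) + Z_1(Y))`. -/
theorem card_codimOne_le (Y : Finset (Fin 2 → Fin m → ZMod 2)) (hY : Y ≠ Finset.univ) :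
    (Y.filter fun y => codimY m Y y = 1).card ≤
      2 ^ m * (Y.filter fun y => y 0 = 0).card + 2 ^ m * (Y.filter fun y => y 1 = 0).card := by
  classical
  set U := Y.filter fun y => codimY m Y y = 1 with hU
  have hV : Fintype.card (Fin m → ZMod 2) = 2 ^ m := by rw [Fintype.card_fun, ZMod.card, Fintype.card_fin]
  -- split `U` into columns `y_0 = a`
  have hfib : U.card = ∑ a : Fin m → ZMod 2, (U.filter fun y => y 0 = a).card :=
    Finset.card_eq_sum_card_fiberwise (f := fun y : Fin 2 → Fin m → ZMod 2 => y 0) (t := Finset.univ)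
      fun _ _ => Finset.mem_coe.mpr (Finset.mem_univ _)
  -- every column has at most `2^m` points
  have hcol : ∀ a : Fin m → ZMod 2, (U.filter fun y => y 0 = a).card ≤ 2 ^ m := by
    intro a
    rw [← hV, ← Finset.card_univ]
    exact Finset.card_le_card_of_injOn (fun y => y 1) (fun _ _ => Finset.mem_coe.mpr (Finset.mem_univ _)) injOn_snd
  -- a column with `(a, 0) ∉ Y` is dominated by the column of `Y` over `a = 0`
  have hdom : ∀ a : Fin m → ZMod 2, ![a, 0] ∉ Y →
      (U.filter fun y => y 0 = a).card ≤ (Y.filter fun y => y 0 = 0).card := by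
    intro a ha
    set Ua := (U.filter fun y => y 0 = a).image fun y => y 1 with hUa_def
    set Y0 := (Y.filter fun y => y 0 = 0).image fun y => y 1 with hY0_def
    have hUa : (U.filter fun y => y 0 = a).card = Ua.card := (Finset.card_image_of_injOn injOn_snd).symm
    have hY0 : Y0.card ≤ (Y.filter fun y => y 0 = 0).card := Finset.card_image_le
    have key : ∀ b ∈ Ua, ∃ φ : (Fin m → ZMod 2) →ₗ[ZMod 2] ZMod 2, ∃ c : ZMod 2,
        φ b = 1 ∧ ∀ v, φ v = c → v ∈ Y0 := by
      intro b hb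
      obtain ⟨y, hy, hyb⟩ := Finset.mem_image.mp hb
      obtain ⟨hyU, hy0⟩ := Finset.mem_filter.mp hy
      obtain ⟨hyY, hy1⟩ := Finset.mem_filter.mp hyU
      obtain ⟨f, hf⟩ := exists_functional_of_codimY_eq_one hY hyY hy1
      -- `φ(v) = f(0, v)`, so `f(a', v) = f(a', 0) + φ(v)`
      let φ : (Fin m → ZMod 2) →ₗ[ZMod 2] ZMod 2 :=
        f.comp (LinearMap.single (ZMod 2) (fun _ : Fin 2 => Fin m → ZMod 2) 1)
      have hφ : ∀ v, φ v = f ![0, v] := by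
        intro v
        change f (Pi.single (1 : Fin 2) v) = f ![0, v]
        congr 1
        funext i; fin_cases i <;> simp
      have hsplit : ∀ a' v : Fin m → ZMod 2, f ![a', v] = f ![a', 0] + f ![0, v] := by
        intro a' v
        rw [← map_add]
        congr 1
        funext i; fin_cases i <;> simp
      have hya : y = ![a, b] := by rw [← hy0, ← hyb]; exact (vec2_eta y).symm
      refine ⟨φ, f y, ?_, ?_⟩
      · -- the hyperplane's column at `a` misses `0`, so `φ b = 1`
        rw [hφ]
        by_contra hne
        have h0 : f ![0, b] = 0 := by
          generalize f ![0, b] = x at hne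
          revert hne x; decide
        apply ha
        apply hf
        rw [hya, hsplit a b, h0, add_zero]
      · -- the hyperplane's column at `0` lies in `Y_0`
        intro v hv
        rw [hφ] at hv
        exact Finset.mem_image.mpr ⟨![0, v], Finset.mem_filter.mpr ⟨hf _ hv, by simp⟩, by simp⟩
    choose! Φ C hΦ using key
    rw [hUa]
    exact (card_le_of_cosets Ua Y0 Φ C hΦ).trans hY0
  -- the columns containing `(a, 0)` are counted by `Z_1(Y)`
  have hZ1 : ((Finset.univ : Finset (Fin m → ZMod 2)).filter fun a => ![a, 0] ∈ Y).card =
      (Y.filter fun y => y 1 = 0).card := by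
    apply Finset.card_nbij' (fun a => ![a, 0]) (fun y => y 0)
    · intro a ha
      have h := (Finset.mem_filter.mp (Finset.mem_coe.mp ha)).2
      exact Finset.mem_coe.mpr (Finset.mem_filter.mpr ⟨h, by simp⟩)
    · intro y hy
      obtain ⟨hyY, hy1⟩ := Finset.mem_filter.mp (Finset.mem_coe.mp hy)
      refine Finset.mem_coe.mpr (Finset.mem_filter.mpr ⟨Finset.mem_univ _, ?_⟩)
      have e : ![y 0, 0] = y := by rw [← hy1]; exact vec2_eta y
      rw [e]; exact hyY
    · intro a _; simp
    · intro y hy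
      obtain ⟨_, hy1⟩ := Finset.mem_filter.mp (Finset.mem_coe.mp hy)
      change ![y 0, 0] = y
      rw [← hy1]; exact vec2_eta y
  -- add up
  rw [hfib, ← Finset.sum_filter_add_sum_filter_not Finset.univ (fun a => ![a, 0] ∈ Y)]
  have h1 : ∑ a ∈ Finset.univ.filter (fun a => ![a, 0] ∈ Y), (U.filter fun y => y 0 = a).card ≤
      2 ^ m * (Y.filter fun y => y 1 = 0).card := by
    calc ∑ a ∈ Finset.univ.filter (fun a => ![a, 0] ∈ Y), (U.filter fun y => y 0 = a).card
        ≤ (Finset.univ.filter (fun a => ![a, 0] ∈ Y)).card • (2 ^ m) :=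
          Finset.sum_le_card_nsmul _ _ _ fun a _ => hcol a
      _ = 2 ^ m * (Y.filter fun y => y 1 = 0).card := by rw [hZ1, smul_eq_mul, mul_comm]
  have h2 : ∑ a ∈ Finset.univ.filter (fun a => ¬ ![a, 0] ∈ Y), (U.filter fun y => y 0 = a).card ≤
      2 ^ m * (Y.filter fun y => y 0 = 0).card := by
    calc ∑ a ∈ Finset.univ.filter (fun a => ¬ ![a, 0] ∈ Y), (U.filter fun y => y 0 = a).card
        ≤ (Finset.univ.filter (fun a => ¬ ![a, 0] ∈ Y)).card • (Y.filter fun y => y 0 = 0).card :=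
          Finset.sum_le_card_nsmul _ _ _ fun a ha => hdom a (Finset.mem_filter.mp ha).2
      _ ≤ (Finset.univ : Finset (Fin m → ZMod 2)).card • (Y.filter fun y => y 0 = 0).card := by
          rw [smul_eq_mul, smul_eq_mul]
          exact Nat.mul_le_mul_right _ (Finset.card_filter_le _ _)
      _ = 2 ^ m * (Y.filter fun y => y 0 = 0).card := by rw [Finset.card_univ, hV, smul_eq_mul]
  omega

/-- Two blocks, `Y ≠ univ`: the left side of the certificate is at most the number of points of codimension exactly `1`. -/
theorem lhs_le_card_codimOne (Y : Finset (Fin 2 → Fin m → ZMod 2)) (hY : Y ≠ Finset.univ) :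
    ∑ y ∈ Y, (((2 : ℕ) : ℤ) - (codimY m Y y : ℤ)) ≤ ((Y.filter fun y => codimY m Y y = 1).card : ℤ) := by
  rw [Finset.card_eq_sum_ones, Nat.cast_sum, Finset.sum_filter]
  apply Finset.sum_le_sum
  intro y hy
  have h1 := one_le_codimY hY hy
  split_ifs with h
  · rw [h]; norm_num
  · push_cast
    have : 2 ≤ codimY m Y y := by omega
    omega

end Flats

/-- **Registered stub `stub_ucLeTwo`** of the line `layer` (stmt-PneNP-19683), BY NAME: the universal block certificate for at most two
blocks and every `m` (line card §UC2). -/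
theorem stub_ucLeTwo : UCLeTwo := by
  intro n m hn Y
  obtain rfl | rfl | rfl : n = 0 ∨ n = 1 ∨ n = 2 := by omega
  · -- no blocks: every term is `−codim ≤ 0` and the right side is empty
    unfold UCIneq
    rw [Finset.univ_eq_empty, Finset.sum_empty]
    exact Finset.sum_nonpos fun y _ => by simp
  · -- one block
    by_cases hY : Y = Finset.univ
    · subst hY; exact ucIneq_univ 1 m
    · unfold UCIneq
      calc ∑ y ∈ Y, (((1 : ℕ) : ℤ) - (codimY m Y y : ℤ)) ≤ 0 :=
            Finset.sum_nonpos fun y hy => by have := one_le_codimY hY hy; push_cast; omega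
        _ ≤ ∑ k : Fin 1, (2 : ℤ) ^ m * ((Y.filter fun y => y k = 0).card : ℤ) :=
            Finset.sum_nonneg fun k _ => by positivity
  · -- two blocks
    by_cases hY : Y = Finset.univ
    · subst hY; exact ucIneq_univ 2 m
    · unfold UCIneq
      rw [Fin.sum_univ_two]
      have h := card_codimOne_le Y hY
      have h' := lhs_le_card_codimOne Y hY
      have h'' : (((Y.filter fun y => codimY m Y y = 1).card : ℕ) : ℤ) ≤
          (2 : ℤ) ^ m * ((Y.filter fun y => y 0 = 0).card : ℤ) + (2 : ℤ) ^ m * ((Y.filter fun y => y 1 = 0).card : ℤ) := by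
        exact_mod_cast h
      exact h'.trans h''

end Summit.PneNP.PneNP.Theorems.ClusLayer
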